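import Summits.Schanuel.Schanuel.Theorems.RootDecomp1KHyper66

/-!
# RootDecomp1KHyper — lens 6, generation 17 «BILOG STAIRCASE CELL» (BilogStair.lean edition 5 aca95ecc…, 4212 l; §N–§O) — continuation (RootDecomp1KHyper67): §N the typed inputs `ConjDataII` (UNDECIDED) / `NonVanishII`, the `T`-expansion `toPolyT`, the inner resultant `resT`, product formula, zero structure `resT_zero`, value bound `norm_resT_le`, `plen`, length/degree bounds `resT_bounds`

(lens-6 g17 `BilogStair.lean` EDITION 5, sha256 aca95ecc…629b, 4212 l, own farm rc 0 · 0 warn · 0 sorry · axioms std; §A–§M = editions 2–4 (ported as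
`RootDecomp1KHyper53`–`66`), §N–§O appended in edition 5 (NODE/EDITION5 L1783, statement diff 0 removed / 0 changed / 36 added; critic ACK L1789: additive,
verified symbol by symbol, PORT may proceed FROM ed.5 as one edition); port by census-1 gen 16 in parts `RootDecomp1KHyper67`–`69` — 67 = §N `ConjDataII` (Prop def,
UNDECIDED), `toPolyT`, `resT`, `NonVanishII` (Prop def), product formula `aeval_resT`, `resT_zero`, `norm_resT_le`, `plen`, `resT_bounds`; 68 = §N `innerNormII_of_pieces :
ConjDataII → NonVanishII → InnerNormII` (PROVED; one exponent uniform in k) + `transferII_of_conjData`; 69 = §O `specXY`, `sliceT`, `exists_root_slice_eq_zero`,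
`nonVanishII_holds : NonVanishII` (PROVED), `transferII_of_conjDataII : ConjDataII → TransferII`. PORT edits: eight generic one-liners private (per-part copies);
sixteen one-line docstrings added; statements and proofs otherwise verbatim. INSTRUMENTS of record, NO credit (critic L1789: TransferII is REDUCED to ConjDataII alone;
`conjDataII_holds` ⇒ TransferII proved as typed ⇒ ONE THEOREM credit on arrival; cell credit needs TransferI + member package). `--supports stmt-Schanuel-33363`; rung 0.)
-/

open Complex Polynomial IntermediateField Filter
open scoped BigOperators

namespace Summit.Schanuel.Schanuel.Theorems.RootDecomp1KHyper

namespace HyperCell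

namespace LatCell

namespace Bilog

variable {n : ℕ}
open Summit.Schanuel.Schanuel.Theorems.RootDecomp1KRelLiouvilleCell (mvPolyMeasure_one_of_polyMeasure ycoeff
  mvaeval_cons_eq_sum mvlen_ycoeff_le natDegree_finSuccEquiv_le_totalDegree norm_mvaeval_le_mvlen_mul_pow)

section InnerRes

/-! ## §N  INNER NORM ⟸ CONJUGATE DATA ∧ NON-VANISHING: the inner resultant `Res_T(f_k, G)`

The intended `N_k` of `InnerNormII` is `resT f_k G := Res_T(f_k(T), G(x₁, x₂, T)) ∈ ℤ[x₁, x₂]` for an integer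
polynomial `f_k ≠ 0` vanishing at `γ_k` whose complex roots are conjugates of `γ_k`.  Here: the `T`-expansion
`toPolyT`, `resT`, the product formula at a complex point, the ZERO STRUCTURE (clause (v) of `InnerNormII`, PROVED
for every such `f`), the raw VALUE BOUND (clause (iv) in raw form, PROVED) and the raw LENGTH/DEGREE bounds
(clauses (ii)–(iii) in raw form, PROVED); and the two residual inputs typed: `ConjDataII` (conjugate data of
`γ_k = e^{iπa_k} α^{b_k}`: degree `≤ H^c`, coefficients `≤ exp(H^c)`, roots `≤ exp(H^c)`) and `NonVanishII`
(`resT f G ≠ 0` for `k` large, from degree growth; PROVED in §O); the assembly `innerNormII_of_pieces`. -/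

/-- **CONJUGATE DATA** of `γ_k` (typed — UNDECIDED; pure algebraic number theory: `γ_k^{2 den a_k den b_k} =
α^{2 den a_k num b_k}`, so `deg γ_k ≤ 2H_k² deg α`, the conjugates have modulus `≤ house(α^{±1})^{2H_k²}`, a
denominator of `γ_k` divides `den(α^{±1})^{2H_k²}`, and `f_k := den^{deg} · minpoly` has coefficients
`≤ exp(O(H_k⁴))`).  CAVEAT for g18: clause 3 (every complex root of `f_k` is a `ℚ`-conjugate of `γ_k`) forces
`f_k` to be a power of the minimal polynomial — the convenient resultant `Res_u(P_α(u), T^N − u^M) ∈ ℤ[T]`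
(`N = 2 den a_k den b_k`) vanishes at `γ_k` with explicit bounds but has NON-conjugate roots in general
(`α = 4`, `γ = 2`, root `−2`); blueprint: `β_k := D_k γ_k` an algebraic integer (`D_k = lc(P_α)^{|M|}` resp.
`P_α(0)^{|M|}`), `f_k(T) := (minpoly ℤ β_k)(D_k T)`, degree `≤ N · deg α` (it divides the resultant), roots =
conjugates (irreducibility + scaling), coefficients by `Polynomial.coeff_bdd_of_roots_le` and the house bound
`|γ'| ≤ house(α^{±1})^{|M|}` read off `γ'^N = α_j^M`. -/
def ConjDataII : Prop :=
  ∀ (ℓ : ℝ) (a b : ℕ → ℚ), IsAlgebraic ℚ (cexp ((ℓ : ℂ) * I)) →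
    ∃ (f : ℕ → ℤ[X]) (c : ℕ),
      (∀ k, f k ≠ 0) ∧ (∀ k, Polynomial.aeval (gam ℓ a b k) (f k) = 0) ∧
      (∀ k (z : ℂ), Polynomial.aeval z (f k) = 0 → IsConjRoot ℚ (gam ℓ a b k) z) ∧
      (∀ᶠ k in atTop, ((f k).natDegree : ℝ) ≤ hgt a b k ^ c) ∧
      (∀ᶠ k in atTop, ∀ i, (|(f k).coeff i| : ℝ) ≤ Real.exp (hgt a b k ^ c)) ∧
      (∀ᶠ k in atTop, ∀ z : ℂ, Polynomial.aeval z (f k) = 0 → ‖z‖ ≤ Real.exp (hgt a b k ^ c))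

/-- The `T`-expansion `G(x₁, x₂, T) ↦ Σ_i G_i(x₁, x₂) T^i`. -/
noncomputable def toPolyT : MvPolynomial (Fin 3) ℤ →ₐ[ℤ] Polynomial (MvPolynomial (Fin 2) ℤ) :=
  (MvPolynomial.finSuccEquiv ℤ 2).toAlgHom.comp (MvPolynomial.rename (finRotate 3))

/-- Definition unfolding of `toPolyT`. -/
theorem toPolyT_apply (G : MvPolynomial (Fin 3) ℤ) :
    toPolyT G = MvPolynomial.finSuccEquiv ℤ 2 (MvPolynomial.rename (finRotate 3) G) := rfl

/-- The inner resultant `Res_T(f(T), G(x₁, x₂, T)) ∈ ℤ[x₁, x₂]`. -/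
noncomputable def resT (f : ℤ[X]) (G : MvPolynomial (Fin 3) ℤ) : MvPolynomial (Fin 2) ℤ :=
  Polynomial.resultant (f.map (MvPolynomial.C : ℤ →+* MvPolynomial (Fin 2) ℤ)) (toPolyT G) f.natDegree
    (toPolyT G).natDegree

/-- **NON-VANISHING** of the inner resultant for large `k` (typed — UNDECIDED; from `DegGrowth`: for `k` large
no coefficient `g(T)` of `G` (degree `≤ deg G`) vanishes at a conjugate of `γ_k`, so every `G(x₁, x₂, γ') ≠ 0`
and `Res_T = lc^n ∏ G(x₁, x₂, γ')` has a complex non-root). -/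
def NonVanishII : Prop :=
  ∀ (ℓ : ℝ) (a b : ℕ → ℚ), DegGrowth (gam ℓ a b) → ∀ G : MvPolynomial (Fin 3) ℤ, G ≠ 0 →
    ∀ᶠ k in atTop, ∀ f : ℤ[X], f ≠ 0 → Polynomial.aeval (gam ℓ a b k) f = 0 →
      (∀ z : ℂ, Polynomial.aeval z f = 0 → IsConjRoot ℚ (gam ℓ a b k) z) → resT f G ≠ 0

/-- `finRotate 3` sends `0 ↦ 1`. -/
private theorem finRotate3_0 : finRotate 3 0 = 1 := by decide
/-- `finRotate 3` sends `1 ↦ 2`. -/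
private theorem finRotate3_1 : finRotate 3 1 = 2 := by decide
/-- `finRotate 3` sends `2 ↦ 0`. -/
private theorem finRotate3_2 : finRotate 3 2 = 0 := by decide

/-- `toPolyT X₀ = C X₀`. -/
theorem toPolyT_X_zero : toPolyT (MvPolynomial.X 0) = Polynomial.C (MvPolynomial.X 0) := by
  rw [toPolyT_apply, MvPolynomial.rename_X, finRotate3_0,
    show (1 : Fin 3) = Fin.succ 0 from rfl, MvPolynomial.finSuccEquiv_X_succ]

/-- `toPolyT X₁ = C X₁`. -/
theorem toPolyT_X_one : toPolyT (MvPolynomial.X 1) = Polynomial.C (MvPolynomial.X 1) := by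
  rw [toPolyT_apply, MvPolynomial.rename_X, finRotate3_1,
    show (2 : Fin 3) = Fin.succ 1 from rfl, MvPolynomial.finSuccEquiv_X_succ]

/-- `toPolyT X₂ = X` (the `T`-variable). -/
theorem toPolyT_X_two : toPolyT (MvPolynomial.X 2) = Polynomial.X := by
  rw [toPolyT_apply, MvPolynomial.rename_X, finRotate3_2, MvPolynomial.finSuccEquiv_X_zero]

/-- `toPolyT (C c) = C (C c)`. -/
theorem toPolyT_C (c : ℤ) : toPolyT (MvPolynomial.C c) = Polynomial.C (MvPolynomial.C c) := by
  rw [toPolyT_apply, MvPolynomial.rename_C, MvPolynomial.finSuccEquiv_apply, MvPolynomial.eval₂Hom_C,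
    RingHom.comp_apply]

/-- Evaluation: `(Σ_i G_i(x, y) T^i)(t) = G(x, y, t)`. -/
theorem eval_map_toPolyT (G : MvPolynomial (Fin 3) ℤ) (x y t : ℂ) :
    ((toPolyT G).map (MvPolynomial.aeval ![x, y]).toRingHom).eval t = MvPolynomial.aeval ![x, y, t] G := by
  induction G using MvPolynomial.induction_on with
  | C a =>
    rw [toPolyT_C, Polynomial.map_C, Polynomial.eval_C, MvPolynomial.aeval_C]
    simp
  | add p q hp hq => rw [map_add, Polynomial.map_add, Polynomial.eval_add, hp, hq, map_add]
  | mul_X p i hp =>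
    rw [map_mul, Polynomial.map_mul, Polynomial.eval_mul, hp, map_mul, MvPolynomial.aeval_X]
    congr 1
    match i with
    | 0 =>
      rw [toPolyT_X_zero, Polynomial.map_C, Polynomial.eval_C]
      simp
    | 1 =>
      rw [toPolyT_X_one, Polynomial.map_C, Polynomial.eval_C]
      simp
    | 2 =>
      rw [toPolyT_X_two, Polynomial.map_X, Polynomial.eval_X]
      simp

/-- `deg_T (toPolyT G) ≤ totalDegree G`. -/
theorem natDegree_toPolyT_le (G : MvPolynomial (Fin 3) ℤ) : (toPolyT G).natDegree ≤ G.totalDegree :=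
  (natDegree_finSuccEquiv_le_totalDegree _).trans (MvPolynomial.totalDegree_rename_le _ _)

/-- Coefficients of `toPolyT G` have length `≤ mvlen G`. -/
theorem mvlen_toPolyT_coeff_le (G : MvPolynomial (Fin 3) ℤ) (i : ℕ) :
    mvlen ((toPolyT G).coeff i) ≤ mvlen G := by
  rw [toPolyT_apply, show (MvPolynomial.finSuccEquiv ℤ 2 (MvPolynomial.rename (finRotate 3) G)).coeff i =
    ycoeff (MvPolynomial.rename (finRotate 3) G) i from rfl]
  exact (mvlen_ycoeff_le _ _).trans (mvlen_rename _ (finRotate 3).injective G).le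

/-- Coefficients of `toPolyT G` have total degree `≤ totalDegree G`. -/
theorem totalDegree_toPolyT_coeff_le (G : MvPolynomial (Fin 3) ℤ) (i : ℕ) :
    ((toPolyT G).coeff i).totalDegree ≤ G.totalDegree := by
  by_cases h : (toPolyT G).coeff i = 0
  · rw [h, MvPolynomial.totalDegree_zero]; exact Nat.zero_le _
  · rw [toPolyT_apply] at h ⊢
    exact (le_of_add_le_left (MvPolynomial.totalDegree_coeff_finSuccEquiv_add_le _ i h)).trans
      (MvPolynomial.totalDegree_rename_le _ _)

/-- The product formula for the inner resultant at a complex point `(x, y)`. -/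
theorem aeval_resT (f : ℤ[X]) (G : MvPolynomial (Fin 3) ℤ) (x y : ℂ) :
    MvPolynomial.aeval ![x, y] (resT f G) =
      (f.map (Int.castRingHom ℂ)).leadingCoeff ^ (toPolyT G).natDegree *
        ((f.map (Int.castRingHom ℂ)).roots.map fun z => MvPolynomial.aeval ![x, y, z] G).prod := by
  classical
  obtain ⟨fC, hfC⟩ : ∃ fC : ℂ[X], fC = f.map (Int.castRingHom ℂ) := ⟨_, rfl⟩
  have hmap : (f.map (MvPolynomial.C : ℤ →+* MvPolynomial (Fin 2) ℤ)).map
      (MvPolynomial.aeval ![x, y]).toRingHom = fC := by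
    rw [hfC, Polynomial.map_map]
    congr 1
    exact Subsingleton.elim _ _
  have hdeg : fC.natDegree = f.natDegree := by
    rw [hfC]; exact Polynomial.natDegree_map_eq_of_injective Int.cast_injective f
  rw [← hfC]
  unfold resT
  rw [show MvPolynomial.aeval ![x, y] (Polynomial.resultant (f.map MvPolynomial.C) (toPolyT G) f.natDegree
      (toPolyT G).natDegree) = (MvPolynomial.aeval ![x, y]).toRingHom (Polynomial.resultant
      (f.map MvPolynomial.C) (toPolyT G) f.natDegree (toPolyT G).natDegree) from rfl,
    ← Polynomial.resultant_map_map, hmap, ← hdeg,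
    Polynomial.resultant_eq_prod_eval fC _ _ Polynomial.natDegree_map_le (IsAlgClosed.splits fC)]
  congr 2
  exact Multiset.map_congr rfl fun z _ => eval_map_toPolyT G x y z

/-- Roots of the complexified integer polynomial are its complex zeros. -/
private theorem mem_roots_map_iff {f : ℤ[X]} (hf : f ≠ 0) (z : ℂ) :
    z ∈ (f.map (Int.castRingHom ℂ)).roots ↔ Polynomial.aeval z f = 0 := by
  rw [Polynomial.mem_roots ((Polynomial.map_ne_zero_iff (Int.castRingHom ℂ).injective_int).mpr hf),
    Polynomial.IsRoot.def, Polynomial.eval_map, Polynomial.aeval_def, algebraMap_int_eq]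

/-- **ZERO STRUCTURE** (clause (v) of `InnerNormII`, PROVED): a zero of `Res_T(f, G)(x, y)` comes from a root
`z` of `f` with `G(x, y, z) = 0`. -/
theorem resT_zero {f : ℤ[X]} (hf : f ≠ 0) (G : MvPolynomial (Fin 3) ℤ) {x y : ℂ}
    (h : MvPolynomial.aeval ![x, y] (resT f G) = 0) :
    ∃ z : ℂ, Polynomial.aeval z f = 0 ∧ MvPolynomial.aeval ![x, y, z] G = 0 := by
  classical
  rw [aeval_resT f G x y] at h
  have hlc : (f.map (Int.castRingHom ℂ)).leadingCoeff ≠ 0 :=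
    Polynomial.leadingCoeff_ne_zero.mpr ((Polynomial.map_ne_zero_iff (Int.castRingHom ℂ).injective_int).mpr hf)
  rcases mul_eq_zero.mp h with h1 | h1
  · exact absurd (pow_eq_zero_iff'.mp h1).1 hlc
  · obtain ⟨z, hz, hz0⟩ := Multiset.mem_map.mp (Multiset.prod_eq_zero_iff.mp h1)
    exact ⟨z, (mem_roots_map_iff hf z).mp hz, hz0⟩

/-- norms of a multiset product with bounded factors -/
private theorem norm_multiset_prod_le {s : Multiset ℂ} {g : ℂ → ℂ} {M : ℝ} (hM : 0 ≤ M)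
    (h : ∀ z ∈ s, ‖g z‖ ≤ M) : ‖(s.map g).prod‖ ≤ M ^ Multiset.card s := by
  induction s using Multiset.induction_on with
  | empty => simp
  | cons a s ih =>
    rw [Multiset.map_cons, Multiset.prod_cons, norm_mul, Multiset.card_cons, pow_succ']
    exact mul_le_mul (h a (Multiset.mem_cons_self a s)) (ih fun z hz => h z (Multiset.mem_cons_of_mem hz))
      (norm_nonneg _) hM

/-- **VALUE BOUND** (clause (iv) of `InnerNormII`, raw form, PROVED): at a point `(x, y)` with `‖x‖, ‖y‖ ≤ R` and
all roots of `f` of modulus `≤ R` (`R ≥ 1`), for a root `γ` of `f ≠ 0`: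
`‖Res_T(f, G)(x, y)‖ ≤ |lc f|^n · (mvlen G · R^{deg G})^{deg f − 1} · ‖G(x, y, γ)‖`. -/
theorem norm_resT_le {f : ℤ[X]} (hf : f ≠ 0) {G : MvPolynomial (Fin 3) ℤ} (hG : G ≠ 0) {x y γ : ℂ}
    (hγ : Polynomial.aeval γ f = 0) {R : ℝ} (hR : 1 ≤ R) (hx : ‖x‖ ≤ R) (hy : ‖y‖ ≤ R)
    (hroots : ∀ z : ℂ, Polynomial.aeval z f = 0 → ‖z‖ ≤ R) :
    ‖MvPolynomial.aeval ![x, y] (resT f G)‖ ≤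
      (|(f.leadingCoeff : ℝ)|) ^ (toPolyT G).natDegree *
        ((((mvlen G : ℤ) : ℝ) * R ^ G.totalDegree) ^ (f.natDegree - 1) *
          ‖MvPolynomial.aeval ![x, y, γ] G‖) := by
  classical
  rw [aeval_resT f G x y, norm_mul, norm_pow]
  have hf' : f.map (Int.castRingHom ℂ) ≠ 0 := (Polynomial.map_ne_zero_iff (Int.castRingHom ℂ).injective_int).mpr hf
  have hlc : ‖(f.map (Int.castRingHom ℂ)).leadingCoeff‖ = |(f.leadingCoeff : ℝ)| := by
    rw [Polynomial.leadingCoeff, Polynomial.leadingCoeff,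
      Polynomial.natDegree_map_eq_of_injective Int.cast_injective f, Polynomial.coeff_map, eq_intCast,
      Complex.norm_intCast]
  rw [hlc]
  refine mul_le_mul_of_nonneg_left ?_ (pow_nonneg (abs_nonneg _) _)
  -- split off the root `γ`
  obtain ⟨s, hs⟩ := Multiset.exists_cons_of_mem ((mem_roots_map_iff hf γ).mpr hγ)
  rw [hs, Multiset.map_cons, Multiset.prod_cons, norm_mul, mul_comm]
  have hM0 : (0 : ℝ) ≤ ((mvlen G : ℤ) : ℝ) * R ^ G.totalDegree :=
    mul_nonneg (by exact_mod_cast mvlen_nonneg G) (pow_nonneg (by linarith) _)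
  have hM1 : (1 : ℝ) ≤ ((mvlen G : ℤ) : ℝ) * R ^ G.totalDegree := by
    have h1 : (1 : ℝ) ≤ ((mvlen G : ℤ) : ℝ) := by exact_mod_cast one_le_mvlen hG
    nlinarith [one_le_pow₀ (M₀ := ℝ) hR (n := G.totalDegree)]
  have hfac : ∀ z ∈ s, ‖MvPolynomial.aeval ![x, y, z] G‖ ≤ ((mvlen G : ℤ) : ℝ) * R ^ G.totalDegree := by
    intro z hz
    have hzr : Polynomial.aeval z f = 0 :=
      (mem_roots_map_iff hf z).mp (by rw [hs]; exact Multiset.mem_cons_of_mem hz)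
    refine norm_mvaeval_le_mvlen_mul_pow G _ hR (fun i => ?_) le_rfl
    match i with
    | 0 => exact hx
    | 1 => exact hy
    | 2 => exact hroots z hzr
  have hcard : Multiset.card s ≤ f.natDegree - 1 := by
    have h1 : Multiset.card (f.map (Int.castRingHom ℂ)).roots ≤ f.natDegree :=
      (Polynomial.card_roots' _).trans (Polynomial.natDegree_map_le)
    rw [hs, Multiset.card_cons] at h1
    omega
  calc ‖(Multiset.map (fun z => MvPolynomial.aeval ![x, y, z] G) s).prod‖ * ‖MvPolynomial.aeval ![x, y, γ] G‖
      ≤ (((mvlen G : ℤ) : ℝ) * R ^ G.totalDegree) ^ Multiset.card s * ‖MvPolynomial.aeval ![x, y, γ] G‖ :=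
        mul_le_mul_of_nonneg_right (norm_multiset_prod_le hM0 hfac) (norm_nonneg _)
    _ ≤ (((mvlen G : ℤ) : ℝ) * R ^ G.totalDegree) ^ (f.natDegree - 1) * ‖MvPolynomial.aeval ![x, y, γ] G‖ :=
        mul_le_mul_of_nonneg_right (pow_le_pow_right₀ hM1 hcard) (norm_nonneg _)

/-- `ℓ¹`-length of an integer polynomial. -/
def plen (f : ℤ[X]) : ℤ := ∑ i ∈ f.support, |f.coeff i|

/-- `plen f ≥ 0`. -/
private theorem plen_nonneg (f : ℤ[X]) : 0 ≤ plen f := Finset.sum_nonneg fun _ _ => abs_nonneg _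

/-- `|coeff f i| ≤ plen f`. -/
private theorem abs_coeff_le_plen (f : ℤ[X]) (i : ℕ) : |f.coeff i| ≤ plen f := by
  classical
  by_cases hi : i ∈ f.support
  · exact Finset.single_le_sum (f := fun j => |f.coeff j|) (fun _ _ => abs_nonneg _) hi
  · rw [Polynomial.notMem_support_iff.mp hi, abs_zero]; exact plen_nonneg f

/-- **LENGTH / DEGREE BOUNDS** (clauses (ii)–(iii) of `InnerNormII`, raw form, PROVED). -/
theorem resT_bounds (f : ℤ[X]) (G : MvPolynomial (Fin 3) ℤ) :
    mvlen (resT f G) ≤ (Nat.factorial (f.natDegree + (toPolyT G).natDegree) : ℤ) *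
        (plen f + mvlen G) ^ (f.natDegree + (toPolyT G).natDegree) ∧
      (resT f G).totalDegree ≤ (f.natDegree + (toPolyT G).natDegree) * G.totalDegree := by
  unfold resT
  refine resultant_bounds _ _ _ _ (add_nonneg (plen_nonneg f) (mvlen_nonneg G)) (fun t => ⟨?_, ?_⟩)
    (fun t => ⟨?_, ?_⟩)
  · rw [Polynomial.coeff_map, mvlen_C]
    exact (abs_coeff_le_plen f t).trans (le_add_of_nonneg_right (mvlen_nonneg G))
  · rw [Polynomial.coeff_map, MvPolynomial.totalDegree_C]; exact Nat.zero_le _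
  · exact (mvlen_toPolyT_coeff_le G t).trans (le_add_of_nonneg_left (plen_nonneg f))
  · exact totalDegree_toPolyT_coeff_le G t

end InnerRes

end Bilog
end LatCell
end HyperCell
end Summit.Schanuel.Schanuel.Theorems.RootDecomp1KHyper
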